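import Mathlib
import Literature.NumberTheory.LFunctions.Zhang2022.SkeletonPartOneB
import Literature.NumberTheory.LFunctions.Zhang2022.SkeletonWindowPowers
import Literature.NumberTheory.LFunctions.Zhang2022.Section14GaussSums
import Literature.NumberTheory.LFunctions.DirichletCharacterMulInvPrimitive
import HarnessLib

/-!
# Zhang (2022) toolkit: Lemma 5.6 for the twisted character `χθ̄` (the shape used at (14.8) and (14.6))

Topic `Literature/NumberTheory/LFunctions/Zhang2022` (Landau–Siegel audit tree; verdict-neutral).
Y. Zhang, *Discrete mean estimates and the Landau–Siegel zero*, arXiv:2211.02515v1 (2022)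
[Zhang2022LandauSiegel] — **an unrefereed manuscript under adjudication**; this file is an ADAPTER:
it instantiates the tree THEOREM `Skeleton.lemma56_holds` (Lemma 5.6: for a primitive `θ (mod r)`,
`1 < r < T`, `θ ≠ χ`, `|t| ≤ D`: `|Σ_{p∼P} θ(p)p^{1+it}| ≤ C𝔓e^{−𝓛^{9/2}}`) at the character that the
proofs of (14.5)/(14.6) actually sum over `p ∼ P` (§14 p.79, tex L3945–L3969):

  `Σ_{p∼P} χθ̄(p) Δ(l/(phr))`, with `θ` primitive mod `r`, `θ ≠ χ` ((14.8), "for `1 < r < D³` we use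
  the Mellin transform, Lemma 5.4 (i) and Lemma 5.6"), resp. `θ` non-principal mod `D₂k`, `D ∤ D₂k`
  ((14.6), "any non-principal character `θ (mod D₂k)` can not be induced by the real character `χ`").

The character `χθ̄` is neither primitive nor to the modulus `r`, so Lemma 5.6 does not apply verbatim;
it applies to the PRIMITIVE character `ξ` inducing `χθ̄ (mod Dr)` (generic algebra in
`LFunctions/DirichletCharacterMulInvPrimitive`): `ξ(p) = χ(p)θ̄(p)` for `p ∤ Dr` (all `p ∼ P` once
`r ≤ P`, as `p > P ≥ r` and `p > D`: `Skeleton.bigP_lt_of_mem_primeWindow`, `Typed.Sec14.lt_of_mem_primeWindow`), `1 < cond ξ ∣ Dr < T`, and `ξ ≠ χ` because `θ ≠ 1`.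

* `Skeleton.lemma56_twist` — for `θ (mod r)` with `θ ≠ 1`, `θ ≠ χ (mod Dr)`, `r ≤ P`, `Dr < T`:
  `|Σ_{p∼P} χ(p)θ̄(p)p^{1+it}| ≤ C𝔓e^{−𝓛^{9/2}}` for `|t| ≤ D`, all large `D` under (A), with the SAME
  constant `C` as `Skeleton.Lemma56`;
* `Skeleton.lemma56_twist_primitive` — the same with the binders of `Skeleton.Lemma56`
  (`1 < r`, `θ` primitive mod `r`, `θ ≠ χ`) — the (14.8) shape (`Typed.Sec14.rhs1417On`);
* `Skeleton.lemma56_twist_of_not_dvd` — `θ ≠ 1` to a modulus `r` with `D ∤ r` — the (14.6) shape.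

No Zhang step is restated or asserted (R1): the only manuscript input is the tree theorem
`lemma56_holds`. Nothing here is about Theorems 1–2 or Landau–Siegel zeros.

## References

* Y. Zhang, arXiv:2211.02515v1 (2022), §5 Lemma 5.6 p.27; §14 (14.8) p.79, tex L3945–L3969.
  [cite: Zhang2022LandauSiegel, §5 Lemma 5.6; §14 (14.8)]
* H. L. Montgomery, R. C. Vaughan, *Multiplicative Number Theory I*, CUP (2007), §9.1.
  [cite: MontgomeryVaughan2007, §9.1]
-/

noncomputable section

open Complex Real

namespace Literature.NumberTheory.LFunctions.Zhang2022.Skeleton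

open Literature.NumberTheory.LFunctions

/-- Every `p ∼ P` is prime to `D·r` once `r ≤ P` and `D ≥ 3` (`p` is a prime exceeding both).
[cite: Zhang2022LandauSiegel, §14 p.77 ("`(p, Dk) = 1`")] -/
theorem coprime_mul_of_mem_primeWindow {D p r : ℕ} (hD : 3 ≤ D) (hp : p ∈ primeWindow D)
    (hr : (r : ℝ) ≤ bigP D) (hr0 : 0 < r) : Nat.Coprime p (D * r) := by
  have hprime : p.Prime := (Finset.mem_filter.mp hp).2
  have hDp : D < p := Typed.Sec14.lt_of_mem_primeWindow hD hp
  have hrp : r < p := by exact_mod_cast hr.trans_lt (bigP_lt_of_mem_primeWindow hp)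
  refine Nat.Coprime.mul_right ?_ ?_
  · exact (Nat.Prime.coprime_iff_not_dvd hprime).mpr fun h =>
      absurd (Nat.le_of_dvd (by omega) h) (by omega)
  · exact (Nat.Prime.coprime_iff_not_dvd hprime).mpr fun h =>
      absurd (Nat.le_of_dvd hr0 h) (by omega)

/-- **Lemma 5.6 for the twisted character `χθ̄`.** For all large `D`, under (A): for every modulus
`r ≥ 1` with `r ≤ P` and `Dr < T`, every character `θ (mod r)` with `θ ≠ 1` and `θ ≠ χ` (as
characters to the modulus `Dr`), and every `|t| ≤ D`,
`|Σ_{p∼P} χ(p)θ̄(p)p^{1+it}| ≤ C·𝔓·exp(−𝓛^{9/2})`, with the constant `C` of Lemma 5.6. Proof: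
the sum is `Σ_{p∼P} ξ(p)p^{1+it}` for the primitive `ξ` inducing `χθ̄ (mod Dr)`
(`primitiveCharacter_mul_inv_apply_natCast`; every `p ∼ P` is prime to `Dr`), and `ξ` is admissible
in `Skeleton.lemma56_holds`: `1 < cond ξ` (`one_lt_conductor_mul_inv_of_ne`), `cond ξ ≤ Dr < T`,
`ξ` primitive, `ξ ≠ χ` (`changeLevel_primitiveCharacter_mul_inv_ne`, as `θ ≠ 1`).
[cite: Zhang2022LandauSiegel, §5 Lemma 5.6 p.27; §14 (14.8) p.79, tex L3960] -/
theorem lemma56_twist : ∃ C : ℝ, ForAllLarge fun D _ χ => AssumptionA D χ →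
    ∀ (r : ℕ) [NeZero r], (r : ℝ) ≤ bigP D → ((D * r : ℕ) : ℝ) < bigT D →
      ∀ θ : DirichletCharacter ℂ r, θ ≠ 1 →
        DirichletCharacter.changeLevel (Nat.dvd_mul_left r D) θ ≠
          DirichletCharacter.changeLevel (Nat.dvd_mul_right D r) χ →
        ∀ t : ℝ, |t| ≤ D →
          ‖∑ p ∈ primeWindow D, χ p * θ⁻¹ p * (p : ℂ) ^ (1 + t * I)‖ ≤
            C * frakP D * Real.exp (-(ell D ^ ((9 : ℝ) / 2))) := by
  obtain ⟨C, D₀, h56⟩ := lemma56_holds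
  refine ⟨C, max D₀ 3, fun D _ χ hD hq hp hA r _ hrP hrT θ hθ hne t ht => ?_⟩
  have hD₀ : D₀ ≤ D := le_trans (le_max_left _ _) hD
  have hD3 : 3 ≤ D := le_trans (le_max_right _ _) hD
  -- the product character and the primitive character inducing it
  set η : DirichletCharacter ℂ (D * r) :=
    DirichletCharacter.changeLevel (dvd_mul_right D r) χ *
      (DirichletCharacter.changeLevel (dvd_mul_left r D) θ)⁻¹ with hη
  haveI : NeZero (D * r) := ⟨mul_ne_zero (NeZero.ne D) (NeZero.ne r)⟩
  haveI hc0 : NeZero η.conductor := ⟨DirichletCharacter.conductor_ne_zero η⟩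
  have h1 : 1 < η.conductor := one_lt_conductor_mul_inv_of_ne χ θ hne
  have hdvd : η.conductor ∣ D * r := DirichletCharacter.conductor_dvd_level η
  have h2 : (η.conductor : ℝ) < bigT D := by
    have hle : η.conductor ≤ D * r := Nat.le_of_dvd (Nat.pos_of_ne_zero (NeZero.ne (D * r))) hdvd
    exact lt_of_le_of_lt (by exact_mod_cast hle) hrT
  have h3 : η.primitiveCharacter.IsPrimitive := DirichletCharacter.primitiveCharacter_isPrimitive η
  have h4 : DirichletCharacter.changeLevel (Nat.dvd_mul_left η.conductor D) η.primitiveCharacter ≠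
      DirichletCharacter.changeLevel (Nat.dvd_mul_right D η.conductor) χ :=
    changeLevel_primitiveCharacter_mul_inv_ne χ θ hθ
  have key := h56 D χ hD₀ hq hp hA η.conductor h1 h2 η.primitiveCharacter h3 h4 t ht
  -- the two sums agree term by term
  have hsum : ∑ p ∈ primeWindow D, χ p * θ⁻¹ p * (p : ℂ) ^ (1 + t * I) =
      ∑ p ∈ primeWindow D, η.primitiveCharacter p * (p : ℂ) ^ (1 + t * I) := by
    refine Finset.sum_congr rfl fun p hpW => ?_
    have hcop : Nat.Coprime p (D * r) :=
      coprime_mul_of_mem_primeWindow hD3 hpW hrP (Nat.pos_of_ne_zero (NeZero.ne r))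
    rw [primitiveCharacter_mul_inv_apply_natCast χ θ hcop]
  rw [hsum]
  exact key

/-- **Lemma 5.6 for `χθ̄`, `θ` primitive** — the binders of `Skeleton.Lemma56` (`1 < r`, `θ (mod r)`
primitive, `θ ≠ χ` to the modulus `Dr`) plus `r ≤ P`, `Dr < T`: for `|t| ≤ D`,
`|Σ_{p∼P} χ(p)θ̄(p)p^{1+it}| ≤ C·𝔓·exp(−𝓛^{9/2})`. This is the shape of the `p`-sum inside
`Typed.Sec14.rhs1417On` ((14.8), first `r`-range, "we use … Lemma 5.6").
[cite: Zhang2022LandauSiegel, §14 (14.8) p.79, tex L3960–L3962] -/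
theorem lemma56_twist_primitive : ∃ C : ℝ, ForAllLarge fun D _ χ => AssumptionA D χ →
    ∀ (r : ℕ) [NeZero r], 1 < r → (r : ℝ) ≤ bigP D → ((D * r : ℕ) : ℝ) < bigT D →
      ∀ θ : DirichletCharacter ℂ r, θ.IsPrimitive →
        DirichletCharacter.changeLevel (Nat.dvd_mul_left r D) θ ≠
          DirichletCharacter.changeLevel (Nat.dvd_mul_right D r) χ →
        ∀ t : ℝ, |t| ≤ D →
          ‖∑ p ∈ primeWindow D, χ p * θ⁻¹ p * (p : ℂ) ^ (1 + t * I)‖ ≤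
            C * frakP D * Real.exp (-(ell D ^ ((9 : ℝ) / 2))) := by
  obtain ⟨C, D₀, h⟩ := lemma56_twist
  refine ⟨C, D₀, fun D _ χ hD hq hp hA r _ hr hrP hrT θ hθ hne t ht => ?_⟩
  exact h D χ hD hq hp hA r hrP hrT θ (ne_one_of_isPrimitive_of_one_lt hθ hr) hne t ht

/-- **Lemma 5.6 for `χθ̄`, `θ` non-principal to a modulus not divisible by `D`** — the (14.6) shape:
for `θ ≠ 1` to the modulus `r` with `D ∤ r` (so `θ` "can not be induced by the real character
`χ (mod D)`": `θ = χ (mod Dr)` would force `cond θ = D ∣ r`), `r ≤ P`, `Dr < T`, `|t| ≤ D`: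
`|Σ_{p∼P} χ(p)θ̄(p)p^{1+it}| ≤ C·𝔓·exp(−𝓛^{9/2})`.
[cite: Zhang2022LandauSiegel, §14 (14.6) (proof) p.79, tex L3966–L3969] -/
theorem lemma56_twist_of_not_dvd : ∃ C : ℝ, ForAllLarge fun D _ χ => AssumptionA D χ →
    ∀ (r : ℕ) [NeZero r], (r : ℝ) ≤ bigP D → ((D * r : ℕ) : ℝ) < bigT D → ¬ D ∣ r →
      ∀ θ : DirichletCharacter ℂ r, θ ≠ 1 →
        ∀ t : ℝ, |t| ≤ D →
          ‖∑ p ∈ primeWindow D, χ p * θ⁻¹ p * (p : ℂ) ^ (1 + t * I)‖ ≤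
            C * frakP D * Real.exp (-(ell D ^ ((9 : ℝ) / 2))) := by
  obtain ⟨C, D₀, h⟩ := lemma56_twist
  refine ⟨C, D₀, fun D _ χ hD hq hp hA r _ hrP hrT hDr θ hθ t ht => ?_⟩
  have hne : DirichletCharacter.changeLevel (Nat.dvd_mul_left r D) θ ≠
      DirichletCharacter.changeLevel (Nat.dvd_mul_right D r) χ := by
    haveI : NeZero (D * r) := ⟨mul_ne_zero (NeZero.ne D) (NeZero.ne r)⟩
    intro H
    have hc := congrArg DirichletCharacter.conductor H
    rw [DirichletCharacter.conductor_changeLevel, DirichletCharacter.conductor_changeLevel,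
      (DirichletCharacter.isPrimitive_def _).mp hp] at hc
    exact hDr (hc ▸ DirichletCharacter.conductor_dvd_level θ)
  exact h D χ hD hq hp hA r hrP hrT θ hθ hne t ht

end Literature.NumberTheory.LFunctions.Zhang2022.Skeleton
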